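import Literature.NumberTheory.EllipticCurves.Rank1Residual.Predicates
import Literature.NumberTheory.EllipticCurves.PAdicGrossZagierConstantTermProofs
import Literature.NumberTheory.EllipticCurves.BSDSelmerCMPConverseMaximalOrderProofs
import Literature.NumberTheory.EllipticCurves.QuadraticTwistJInvariantProofs
import Literature.NumberTheory.EllipticCurves.QuadraticTwistPadicReduction
import Literature.NumberTheory.DiophantineGeometry.LocalReductionProofs
import HarnessLib

/-!
# The good-supersingular cells are closed under quadratic twists unramified at `p` and under
# `ℚ`-isogeny: `GoodSS`, `a_p ≠ 0` and class X8 are twist- and isogeny-stable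
# (cell `b2b-bsdres`, supersingular family, prover B = unit `b2b-bsdres-additive-p3`, gen 16;
# CLASS-CLOSURE lane, experiment type E3 "transport search" for §3.12 X8 / §3.11 X7)

HONEST FRAMING (run/shared/lean/b2b/bsd-rank1-residual/, verbatim in every file): the goal of the
cell is to DELETE the COMBINATION-SHAPED residual classes of the Birch–Swinnerton-Dyer formula for
ALL analytic-rank `≤ 1` elliptic curves over `ℚ` — "full BSD formula for every rank `≤ 1` curve in
class `C`" assembled STRICTLY from published theorems — so that the rank-`≤ 1` remainder becomes
exactly the CONSTRUCTION-SHAPED classes, which are TYPED (missing-input `Prop`s), NOT attempted.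
This is not "finishing BSD". THEOREMS ONLY (no definition, no named fact, nothing about any
particular curve asserted); no label of the cell moves; nothing is booked.

## What this file proves, and why

The CLASS-CLOSURE plan (HOME/CLASS-CLOSURE-PLAN.md §1, E3) asks, per open class, for the relations
"open pair ↔ CLOSED pair" by isogeny / quadratic twist / congruence. For class X8
(`Rank1Residual.ClassX8 W p := p = 3 ∧ GoodSS W 3 ∧ a_3(W) ≠ 0`) and for the supersingular
predicate `GoodSS W p := good reduction at p ∧ p ∣ a_p(W)` of X6/X7 the answer is STRUCTURAL and
is proved here once and for all, so that no relations census need be run on these cells: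

* `hasGoodReductionAtPrime_of_smul_eq_quadraticTwist` — a globally minimal model `W'` of the twist
  `E^{(d)}` (`C • W' = W.quadraticTwist d`) has good reduction at every prime `p ∤ 2d` of good
  reduction of `W` (Silverman *AEC* VII.1 Rem. 1.1, VII.5 Prop. 5.1(a): the twisted equation is
  `p`-integral with unit discriminant `d⁶Δ_min`; tree `hasGoodReductionAt_quadraticTwist` +
  isomorphism invariance `hasGoodReductionAt_smul_iff_holds`);
* `frobeniusTrace_of_smul_eq_quadraticTwist` — `a_p(W') = (d/p)·a_p(W)` there (the tree's PROVED
  fact `frobeniusTrace_quadraticTwist_holds`, Knapp Prop. 12.10 / Rubin–Silverberg §1), hence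
  `p ∣ a_p(W') ↔ p ∣ a_p(W)` and `a_p(W') ≠ 0 ↔ a_p(W) ≠ 0` (`(d/p) = ±1` for `p ∤ d`);
* `goodSS_of_smul_eq_quadraticTwist`, **`classX8_of_smul_eq_quadraticTwist`**: `GoodSS` at an odd
  `p ∤ d` and class X8 (twists with `3 ∤ d`) pass to the twist; with the symmetry
  `exists_smul_eq_quadraticTwist_symm` (`W` is in turn a minimal model of `(W')^{(d)}`, since
  `(E^{(d)})^{(d)} = E^{(d²)} ≅ E` — `quadraticTwist_smul`, `quadraticTwist_quadraticTwist`,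
  `exists_variableChange_smul_eq_quadraticTwist_sq`) the `iff` forms `goodSS_iff_…`,
  **`classX8_iff_of_smul_eq_quadraticTwist`**;
* `IsIsogenous.goodSS_iff`, **`IsIsogenous.classX8_iff`** — `GoodSS` and X8 are `ℚ`-isogeny
  invariants (good reduction: *AEC* VII.7.2, tree `IsIsogenous.hasGoodReductionAtPrime_iff`;
  `a_p`: Faltings, tree `frobeniusTrace_eq_of_isIsogenous`).

READING for E3 (numbers of record, rmap-2 GEN 4 kit j112050): X8 has NO closed partner by isogeny
or by a twist unramified at 3; the only exits from X8 are twists RAMIFIED at 3 (`3 ∣ d`: additive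
reduction at 3, classes X3/X4 — themselves open). Twisting inside X8 swaps `a_3 = 3 ↔ −3` when
`(d/3) = −1` and moves pairs between the semistable (912 S-b pairs) and non-semistable (2 299)
sub-cells; semistability is NOT twist-stable and is not claimed here. X7 (`GoodSS ∧ ¬Semistable`)
keeps `GoodSS` under such twists; whether the twist is semistable (→ X6) is exactly BSTW's /
JSW 7.2.1 (iii)'s twist clause (82 ‖ 333 JSW-shape, 64 ‖ 248 BSTW-shape S-b pairs), not a theorem
of this file.

References: [SilvermanAEC2009] VII.1 Rem. 1.1, VII.5 Prop. 5.1(a), VII.7.2, X.5 Cor. 5.4;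
[Knapp1993] Prop. 12.10; [RubinSilverberg2002] §1; [Faltings1983Endlichkeit] §5 Kor. 2.
Design: theorems only; default heartbeats; axioms standard.
-/

set_option autoImplicit false

noncomputable section

open scoped Classical NumberField

open WeierstrassCurve IsDedekindDomain NumberField Rat.HeightOneSpectrum
  Literature.NumberTheory.EllipticCurves
  Literature.NumberTheory.EllipticCurves.Rank1Residual

namespace Summit.BirchSwinnertonDyer.Rank1Residual.Supersingular

/-! ### Quadratic twists unramified at `p` -/

section Twist

variable (W W' : WeierstrassCurve ℚ) [W.IsElliptic] [W.IsGloballyMinimal] [W'.IsGloballyMinimal]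
  (p : ℕ) [hp : Fact p.Prime]

omit [W.IsElliptic] [W'.IsGloballyMinimal] in
/-- **Good reduction passes to the twist at every `p ∤ 2d`**: `W` globally minimal,
`C • W' = W^{(d)}`, `p ∤ 2d`, `W` good at `p` ⟹ `W'` good at `p` (the twisted equation is `p`-integral with `p`-unit discriminant `d⁶ Δ_min(W)`;
good reduction is invariant under `C`). [cite: SilvermanAEC2009, VII.1 Remark 1.1 and VII.5 Prop. 5.1(a)] -/
theorem hasGoodReductionAtPrime_of_smul_eq_quadraticTwist {d : ℤ} {C : VariableChange ℚ}
    (hC : C • W' = W.quadraticTwist (d : ℚ)) (hp2d : ¬ (p : ℤ) ∣ 2 * d)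
    (hgood : W.HasGoodReductionAtPrime p) : W'.HasGoodReductionAtPrime p := by
  have hpP : p.Prime := hp.out
  obtain ⟨v, rfl⟩ : ∃ v : HeightOneSpectrum (𝓞 ℚ), (primesEquiv v : ℕ) = p :=
    ⟨primesEquiv.symm ⟨p, hpP⟩, by rw [Equiv.apply_symm_apply]⟩
  have hΔ : ¬ ((primesEquiv v : ℕ) : ℤ) ∣ W.minimalDiscriminantInt :=
    W.not_dvd_minimalDiscriminantInt_of_hasGoodReductionAtPrime' _ hgood
  have hX : (W.quadraticTwist (d : ℚ)).HasGoodReductionAt v :=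
    W.hasGoodReductionAt_quadraticTwist v hp2d hΔ
  have hW' : W'.HasGoodReductionAt v := by
    rw [← hasGoodReductionAt_smul_iff_holds v W' C, hC]
    exact hX
  exact (hasGoodReductionAtPrime_iff_hasGoodReductionAt_ringOfIntegers v W').mpr hW'

/-- **`a_p(W') = (d/p)·a_p(W)`** for a minimal model `W'` of `W^{(d)}`, `d` square-free,
`p ∤ 2d` a prime of good reduction of `W` (the tree's proved twisting formula
`frobeniusTrace_quadraticTwist_holds`). [cite: Knapp1993, Prop. 12.10] [cite: RubinSilverberg2002, §1] -/
theorem frobeniusTrace_of_smul_eq_quadraticTwist {d : ℤ} (hd : Squarefree d)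
    {C : VariableChange ℚ} (hC : C • W' = W.quadraticTwist (d : ℚ)) (hp2d : ¬ (p : ℤ) ∣ 2 * d)
    (hgood : W.HasGoodReductionAtPrime p) :
    W'.frobeniusTrace p = legendreSym p d * W.frobeniusTrace p :=
  frobeniusTrace_quadraticTwist_holds W W' d hd ⟨C, hC⟩ p hp2d
    (W.not_dvd_minimalDiscriminantInt_of_hasGoodReductionAtPrime' p hgood)

omit W W' [W.IsElliptic] [W.IsGloballyMinimal] [W'.IsGloballyMinimal] in
/-- For `p ∤ 2d` the Legendre symbol `(d/p)` is `±1`. [folklore] -/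
theorem legendreSym_eq_one_or_of_not_dvd {d : ℤ} (hp2d : ¬ (p : ℤ) ∣ 2 * d) :
    legendreSym p d = 1 ∨ legendreSym p d = -1 := by
  have hpd : ¬ (p : ℤ) ∣ d := fun h ↦ hp2d (dvd_mul_of_dvd_right h 2)
  have hd0 : ((d : ℤ) : ZMod p) ≠ 0 := by
    rwa [Ne, ZMod.intCast_zmod_eq_zero_iff_dvd]
  exact legendreSym.eq_one_or_neg_one p hd0

/-- **`p ∣ a_p(W') ↔ p ∣ a_p(W)`** for a twist unramified at the odd good prime `p`
(`(d/p) = ±1`): supersingularity at `p` is twist-stable. [cite: Knapp1993, Prop. 12.10] -/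
theorem dvd_frobeniusTrace_iff_of_smul_eq_quadraticTwist {d : ℤ} (hd : Squarefree d)
    {C : VariableChange ℚ} (hC : C • W' = W.quadraticTwist (d : ℚ)) (hp2d : ¬ (p : ℤ) ∣ 2 * d)
    (hgood : W.HasGoodReductionAtPrime p) :
    (p : ℤ) ∣ W'.frobeniusTrace p ↔ (p : ℤ) ∣ W.frobeniusTrace p := by
  rw [frobeniusTrace_of_smul_eq_quadraticTwist W W' p hd hC hp2d hgood]
  rcases legendreSym_eq_one_or_of_not_dvd p hp2d with h | h <;> rw [h]
  · rw [one_mul]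
  · rw [neg_one_mul, dvd_neg]

/-- **`a_p(W') ≠ 0 ↔ a_p(W) ≠ 0`** for a twist unramified at the odd good prime `p`.
[cite: Knapp1993, Prop. 12.10] -/
theorem frobeniusTrace_ne_zero_iff_of_smul_eq_quadraticTwist {d : ℤ} (hd : Squarefree d)
    {C : VariableChange ℚ} (hC : C • W' = W.quadraticTwist (d : ℚ)) (hp2d : ¬ (p : ℤ) ∣ 2 * d)
    (hgood : W.HasGoodReductionAtPrime p) :
    W'.frobeniusTrace p ≠ 0 ↔ W.frobeniusTrace p ≠ 0 := by
  rw [frobeniusTrace_of_smul_eq_quadraticTwist W W' p hd hC hp2d hgood]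
  rcases legendreSym_eq_one_or_of_not_dvd p hp2d with h | h <;> rw [h]
  · rw [one_mul]
  · rw [neg_one_mul, neg_ne_zero]

/-- **`GoodSS` passes to a twist unramified at the odd prime `p`**: `W` good supersingular at `p`
(`GoodSS W p`), `C • W' = W^{(d)}` with `d` square-free and `p ∤ 2d` ⟹ `GoodSS W' p`.
[cite: SilvermanAEC2009, VII.5 Prop. 5.1(a)] [cite: Knapp1993, Prop. 12.10] -/
theorem goodSS_of_smul_eq_quadraticTwist (hG : GoodSS W p) {d : ℤ} (hd : Squarefree d)
    {C : VariableChange ℚ} (hC : C • W' = W.quadraticTwist (d : ℚ)) (hp2d : ¬ (p : ℤ) ∣ 2 * d) :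
    GoodSS W' p :=
  ⟨hasGoodReductionAtPrime_of_smul_eq_quadraticTwist W W' p hC hp2d hG.1,
    (dvd_frobeniusTrace_iff_of_smul_eq_quadraticTwist W W' p hd hC hp2d hG.1).mpr hG.2⟩

omit hp in
/-- For `3 ∤ d`: `3 ∤ 2d`. [folklore] -/
theorem not_three_dvd_two_mul {d : ℤ} (h3d : ¬ (3 : ℤ) ∣ d) : ¬ ((3 : ℕ) : ℤ) ∣ 2 * d := by
  intro h
  have h3 : Prime (3 : ℤ) := by norm_num
  rcases h3.dvd_or_dvd (by exact_mod_cast h) with h2 | hd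
  · norm_num at h2
  · exact h3d hd

/-- **Class X8 passes to every quadratic twist unramified at `3`**: `W ∈ X8` (`p = 3` good
supersingular, `a_3 = ±3`), `C • W' = W^{(d)}` with `d` square-free, `3 ∤ d`, `W'` globally minimal
⟹ `W' ∈ X8` (`a_3(W') = (d/3)·a_3(W) = ±a_3(W) ≠ 0`). [cite: Knapp1993, Prop. 12.10]
[cite: SilvermanAEC2009, VII.5 Prop. 5.1(a)] -/
theorem classX8_of_smul_eq_quadraticTwist (hX : ClassX8 W p) {d : ℤ} (hd : Squarefree d)
    {C : VariableChange ℚ} (hC : C • W' = W.quadraticTwist (d : ℚ)) (h3d : ¬ (3 : ℤ) ∣ d) :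
    ClassX8 W' p := by
  obtain ⟨hp3, hG, hne⟩ := hX
  subst hp3
  have h32d := not_three_dvd_two_mul h3d
  exact ⟨rfl, goodSS_of_smul_eq_quadraticTwist W W' 3 hG hd hC h32d,
    (frobeniusTrace_ne_zero_iff_of_smul_eq_quadraticTwist W W' 3 hd hC h32d hG.1).mpr hne⟩

/-- Inside X8 the twist acts on `a_3` by the sign `(d/3)`: `a_3(W') = (d/3)·a_3(W)`, so twisting by
`d ≡ 2 (mod 3)` swaps the sub-families `a_3 = 3` and `a_3 = −3`. [cite: Knapp1993, Prop. 12.10] -/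
theorem ClassX8.frobeniusTrace_three_of_smul_eq_quadraticTwist (hX : ClassX8 W p) {d : ℤ}
    (hd : Squarefree d) {C : VariableChange ℚ} (hC : C • W' = W.quadraticTwist (d : ℚ))
    (h3d : ¬ (3 : ℤ) ∣ d) :
    W'.frobeniusTrace 3 = legendreSym 3 d * W.frobeniusTrace 3 :=
  haveI : Fact (3 : ℕ).Prime := ⟨Nat.prime_three⟩
  frobeniusTrace_of_smul_eq_quadraticTwist W W' 3 hd hC (not_three_dvd_two_mul h3d) hX.2.1.1

end Twist

/-! ### Symmetry of the twist relation and the `iff` forms -/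

section Symm

variable (W W' : WeierstrassCurve ℚ) [W.IsElliptic] [W'.IsElliptic]

omit [W.IsElliptic] [W'.IsElliptic] in
/-- **The twist relation is symmetric up to `ℚ`-isomorphism**: if `C • W' = W^{(d)}` with `d ≠ 0`
then `C' • W = (W')^{(d)}` for some change of variables `C'` — because `((W')^{(d)}) ≅ (W^{(d)})^{(d)}
= W^{(d²)} ≅ W` (`quadraticTwist_smul`, `quadraticTwist_quadraticTwist`,
`exists_variableChange_smul_eq_quadraticTwist_sq`). [cite: SilvermanAEC2009, X.5 Cor. 5.4] -/
theorem exists_smul_eq_quadraticTwist_symm {d : ℚ} (hd : d ≠ 0) {C : VariableChange ℚ}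
    (hC : C • W' = W.quadraticTwist d) :
    ∃ C' : VariableChange ℚ, C' • W = W'.quadraticTwist d := by
  -- `W' = C⁻¹ • W^{(d)}`
  have hW' : W' = C⁻¹ • W.quadraticTwist d := by rw [← hC, inv_smul_smul]
  obtain ⟨C₀, hC₀⟩ := W.exists_variableChange_smul_eq_quadraticTwist_sq hd
  refine ⟨(⟨(C⁻¹).u, d * (C⁻¹).r, 0, 0⟩ : VariableChange ℚ) * C₀, ?_⟩
  rw [hW', quadraticTwist_smul, quadraticTwist_quadraticTwist, mul_smul, hC₀, sq]

variable [W.IsGloballyMinimal] [W'.IsGloballyMinimal] (p : ℕ) [hp : Fact p.Prime]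

/-- **`GoodSS W' p ↔ GoodSS W p`** for globally minimal `W, W'` with `C • W' = W^{(d)}`, `d`
square-free, `p ∤ 2d`. [cite: SilvermanAEC2009, VII.5 Prop. 5.1(a)] [cite: Knapp1993, Prop. 12.10] -/
theorem goodSS_iff_of_smul_eq_quadraticTwist {d : ℤ} (hd : Squarefree d)
    {C : VariableChange ℚ} (hC : C • W' = W.quadraticTwist (d : ℚ)) (hp2d : ¬ (p : ℤ) ∣ 2 * d) :
    GoodSS W' p ↔ GoodSS W p := by
  have hd0 : ((d : ℤ) : ℚ) ≠ 0 := by exact_mod_cast hd.ne_zero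
  obtain ⟨C', hC'⟩ := exists_smul_eq_quadraticTwist_symm W W' hd0 hC
  exact ⟨fun h ↦ goodSS_of_smul_eq_quadraticTwist W' W p h hd hC' hp2d,
    fun h ↦ goodSS_of_smul_eq_quadraticTwist W W' p h hd hC hp2d⟩

/-- **`W' ∈ X8 ↔ W ∈ X8`** for globally minimal `W, W'` with `C • W' = W^{(d)}`, `d` square-free,
`3 ∤ d`: class X8 is CLOSED under quadratic twists unramified at `3` (E3 reading: an X8 pair has no
twisted partner outside X8 except through twists ramified at `3`, which land in the additive
classes X3/X4). [cite: Knapp1993, Prop. 12.10] [cite: SilvermanAEC2009, VII.5 Prop. 5.1(a)] -/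
theorem classX8_iff_of_smul_eq_quadraticTwist {d : ℤ} (hd : Squarefree d)
    {C : VariableChange ℚ} (hC : C • W' = W.quadraticTwist (d : ℚ)) (h3d : ¬ (3 : ℤ) ∣ d) :
    ClassX8 W' p ↔ ClassX8 W p := by
  have hd0 : ((d : ℤ) : ℚ) ≠ 0 := by exact_mod_cast hd.ne_zero
  obtain ⟨C', hC'⟩ := exists_smul_eq_quadraticTwist_symm W W' hd0 hC
  exact ⟨fun h ↦ classX8_of_smul_eq_quadraticTwist W' W p h hd hC' h3d,
    fun h ↦ classX8_of_smul_eq_quadraticTwist W W' p h hd hC h3d⟩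

/-- **Every X8 curve has X8 twists by every square-free `d` with `3 ∤ d`**: a globally minimal
model `W'` of `W^{(d)}` exists (*AEC* VIII.8.3, `exists_isGloballyMinimal_smul_eq_quadraticTwist`'s
construction) and lies in X8. [cite: SilvermanAEC2009, VIII.8 Cor. 8.3] [cite: Knapp1993, Prop. 12.10] -/
theorem ClassX8.exists_twist (hX : ClassX8 W p) {d : ℤ} (hd : Squarefree d) (h3d : ¬ (3 : ℤ) ∣ d) :
    ∃ (W' : WeierstrassCurve ℚ) (_ : W'.IsElliptic) (_ : W'.IsGloballyMinimal)
      (C : VariableChange ℚ), C • W' = W.quadraticTwist (d : ℚ) ∧ ClassX8 W' p := by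
  have hd0 : ((d : ℤ) : ℚ) ≠ 0 := by exact_mod_cast hd.ne_zero
  haveI := W.isElliptic_quadraticTwist hd0
  obtain ⟨C, hC⟩ := hasGlobalMinimalModel_rat_holds (W.quadraticTwist (d : ℚ))
  refine ⟨C • W.quadraticTwist (d : ℚ), inferInstance, hC, C⁻¹, inv_smul_smul C _, ?_⟩
  haveI : (C • W.quadraticTwist (d : ℚ)).IsGloballyMinimal := hC
  exact classX8_of_smul_eq_quadraticTwist W (C • W.quadraticTwist (d : ℚ)) p hX hd
    (inv_smul_smul C _) h3d

end Symm

/-! ### `ℚ`-isogeny -/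

section Isogeny

variable {W W' : WeierstrassCurve ℚ} [W.IsElliptic] [W'.IsElliptic] [W.IsGloballyMinimal]
  [W'.IsGloballyMinimal] (p : ℕ) [hp : Fact p.Prime]

/-- **`GoodSS` is a `ℚ`-isogeny invariant**: good reduction at `p` is (Silverman *AEC* VII.7.2,
tree `IsIsogenous.hasGoodReductionAtPrime_iff`) and `a_p` is (Faltings; tree
`frobeniusTrace_eq_of_isIsogenous`). [cite: SilvermanAEC2009, Cor. VII.7.2]
[cite: Faltings1983Endlichkeit, §5 Korollar 2, (i) ⇒ (iv)] -/
theorem IsIsogenous.goodSS_iff (h : IsIsogenous W W') : GoodSS W p ↔ GoodSS W' p := by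
  constructor
  · rintro ⟨hgood, hdvd⟩
    have hgood' := (h.hasGoodReductionAtPrime_iff p).mp hgood
    exact ⟨hgood', by rwa [← frobeniusTrace_eq_of_isIsogenous h p hgood hgood']⟩
  · rintro ⟨hgood', hdvd⟩
    have hgood := (h.hasGoodReductionAtPrime_iff p).mpr hgood'
    exact ⟨hgood, by rwa [frobeniusTrace_eq_of_isIsogenous h p hgood hgood']⟩

/-- **Class X8 is a `ℚ`-isogeny invariant** (`a_3` and good reduction at `3` are): BSD truth being
Cassels-invariant, an X8 pair has no isogenous partner outside X8 — the E3 isogeny search is empty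
on this class. [cite: SilvermanAEC2009, Cor. VII.7.2] [cite: Faltings1983Endlichkeit, §5 Korollar 2, (i) ⇒ (iv)] -/
theorem IsIsogenous.classX8_iff (h : IsIsogenous W W') : ClassX8 W p ↔ ClassX8 W' p := by
  haveI : Fact (3 : ℕ).Prime := ⟨Nat.prime_three⟩
  constructor
  · rintro ⟨hp3, hG, hne⟩
    have hG' := (IsIsogenous.goodSS_iff 3 h).mp hG
    refine ⟨hp3, hG', ?_⟩
    rwa [← frobeniusTrace_eq_of_isIsogenous h 3 hG.1 hG'.1]
  · rintro ⟨hp3, hG', hne⟩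
    have hG := (IsIsogenous.goodSS_iff 3 h).mpr hG'
    refine ⟨hp3, hG, ?_⟩
    rwa [frobeniusTrace_eq_of_isIsogenous h 3 hG.1 hG'.1]

/-- `a_p` is constant on the isogeny class at a good supersingular prime (so the sub-families
`a_3 = 3` / `a_3 = −3` of X8 are isogeny-stable too). [cite: Faltings1983Endlichkeit, §5 Korollar 2, (i) ⇒ (iv)] -/
theorem IsIsogenous.frobeniusTrace_eq_of_goodSS (h : IsIsogenous W W') (hG : GoodSS W p) :
    W.frobeniusTrace p = W'.frobeniusTrace p :=
  frobeniusTrace_eq_of_isIsogenous h p hG.1 ((h.hasGoodReductionAtPrime_iff p).mp hG.1)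

end Isogeny

end Summit.BirchSwinnertonDyer.Rank1Residual.Supersingular

end
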